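import Literature.Combinatorics.StablePolynomials.HypergeometricSampleSizeStep
import Mathlib.RingTheory.Binomial
import HarnessLib

/-!
# The hypergeometric law continued in the sample size, without Gamma functions

For the urn with `m` marked and `d` unmarked balls (`N = m + d`) and `s` draws, the hypergeometric weight of
`j` marked balls is `C(m,j)·C(d,s−j)/C(N,s)`.  The second factor is a POLYNOMIAL in the sample size:

  `C(d, s−j)/C(N, s) = (d!/N!) · s^{(j)} · (N−s)^{(m−j)}`,   `y^{(k)} = y(y−1)⋯(y−k+1)`,

so the law has a canonical continuation to every REAL `s` with rational coefficients (`hyperCont`), which at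
natural `s ≤ N` is the hypergeometric law (`choose_mul_hyperCont_natCast`, stated on the coefficients of the law
polynomial `hyperLaw` of `HypergeometricSampleSizeStep`), sums to `1` for EVERY real `s` by the falling-factorial
Chu–Vandermonde identity (`sum_choose_mul_hyperCont`), and is positive term by term on the genuine range widened by
one (`hyperCont_pos`); outside that range the weights alternate in sign (the «boundary atoms»).

This is the Γ-free form of the «Gamma-continued level-0 law» `P̃_{t/2}` of the cell pnp-psdrank (prover g22's
MEMO-25 §1: `C̃(m,y) = m!/(Γ(y+1)Γ(m−y+1))` at half-integers `y`; the `π`'s cancel in the ratio) and the `c = 0`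
value of the level polynomial `F_x(c)` of LIT-48 (lit g33).  The SHELL form for a matching of H-type `(a,b,d)`
(`a` edges inside `H`, `b` mixed, `d` outside; level `0`, `s` edges; `x = |U ∩ H| = 2α + β`) is
`contLevelZeroLaw a b d s x = Σ_α C(a,α)·C(b,x−2α)·hyperCont (a+b) d s (x−α)` (`sum_contLevelZeroLaw` = 1 for all
real `s`; at natural `s` it is the three-type level-0 law `Σ_α C(a,α)C(b,x−2α)C(d,s−x+α)/C(N,s)` of
`ShellLawLevelStep.card_shellIn_zero_types`, `contLevelZeroLaw_natCast`).

All PROVED, 0 sorry; definitions `ffact`, `hyperCont`, `contLevelZeroLaw`; no named facts.  Requested by prover g22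
(MEMO-25 §5 (L1)); the positivity CONJECTURE (V)/(O1) about Newton-extrapolated shell laws is NOT part of this file.

## References
* [KocherlakotaKocherlakota2017] S. Kocherlakota, K. Kocherlakota, *Bivariate Discrete Distributions*, CRC 2017, §6.3
  eq. (6.3.1) (the hypergeometric law `C(N₁,r)C(N₂,n−r)/C(N,n)`, PDF p. 128), §6.2 eq. (6.2.4) (Guldberg's trivariate
  form), §6.4 (the `₂F₁` form: the weights are rational in the parameters).
* [GrahamKnuthPatashnik1994] R. Graham, D. Knuth, O. Patashnik, *Concrete Mathematics*, 2nd ed. 1994, §2.6 eq. (2.43)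
  (falling factorial powers), §5.1 eq. (5.27) (Vandermonde's convolution).
* [AndrewsAskeyRoy1999] G. Andrews, R. Askey, R. Roy, *Special Functions*, CUP 1999, §2.5 and Cor. 2.2.3
  (Chu–Vandermonde).
* Mathlib `Ring.descPochhammer_smeval_add` (the falling-factorial Vandermonde identity in any ring).
-/

noncomputable section

open Finset Polynomial

namespace Literature.Combinatorics.StablePolynomials

/-! ### §1 Falling factorial powers of a real number -/

/-- The falling factorial power `s^{(k)} = s(s−1)⋯(s−k+1)` of a real number (Mathlib's `descPochhammer ℤ k`
evaluated at `s`). [cite: GrahamKnuthPatashnik1994, §2.6 eq. (2.43)] -/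
def ffact (s : ℝ) (k : ℕ) : ℝ := (descPochhammer ℤ k).smeval s

/-- `s^{(0)} = 1`. [cite: GrahamKnuthPatashnik1994, §2.6 eq. (2.43)] -/
@[simp] theorem ffact_zero (s : ℝ) : ffact s 0 = 1 := by
  simp [ffact]

/-- `s^{(k+1)} = s^{(k)}·(s − k)`. [cite: GrahamKnuthPatashnik1994, §2.6 eq. (2.43)] -/
theorem ffact_succ (s : ℝ) (k : ℕ) : ffact s (k + 1) = ffact s k * (s - k) := by
  unfold ffact
  rw [descPochhammer_succ_right, smeval_mul, smeval_sub, smeval_X, smeval_natCast]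
  simp

/-- At a natural number the falling factorial is `Nat.descFactorial` `n(n−1)⋯(n−k+1)` (zero when `k > n`).
[cite: GrahamKnuthPatashnik1994, §2.6 eq. (2.43)] -/
theorem ffact_natCast (n k : ℕ) : ffact (n : ℝ) k = (n.descFactorial k : ℝ) := by
  unfold ffact
  exact descPochhammer_smeval_eq_descFactorial n k

/-- **Chu–Vandermonde for falling factorials**: `(r+s)^{(k)} = Σ_{i+j=k} C(k,i)·r^{(i)}·s^{(j)}`.
[cite: AndrewsAskeyRoy1999, Cor. 2.2.3] [cite: GrahamKnuthPatashnik1994, §5.1 eq. (5.27)] -/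
theorem ffact_add (r s : ℝ) (k : ℕ) :
    ffact (r + s) k = ∑ ij ∈ antidiagonal k, (k.choose ij.1 : ℝ) * (ffact r ij.1 * ffact s ij.2) := by
  unfold ffact
  rw [Ring.descPochhammer_smeval_add k (Commute.all r s)]

/-- `s^{(k)} > 0` as long as all factors are positive, i.e. `k < s + 1`. [cite: GrahamKnuthPatashnik1994, §2.6 eq. (2.43)] -/
theorem ffact_pos {s : ℝ} {k : ℕ} (h : (k : ℝ) < s + 1) : 0 < ffact s k := by
  induction k with
  | zero => simp
  | succ k ih =>
    rw [ffact_succ]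
    push_cast at h
    exact mul_pos (ih (by linarith)) (by linarith)

/-! ### §2 The continued hypergeometric weight -/

/-- The hypergeometric weight `C(d, s−j)/C(m+d, s)` CONTINUED IN THE SAMPLE SIZE `s`:
`hyperCont m d s j = (d!/(m+d)!) · s^{(j)} · ((m+d)−s)^{(m−j)}` for `j ≤ m` (and `0` for `j > m`) — a polynomial
in `s` of degree `m` with rational coefficients; the law of `j` is `C(m,j) · hyperCont m d s j`.
[cite: KocherlakotaKocherlakota2017, §6.3 eq. (6.3.1)] -/
def hyperCont (m d : ℕ) (s : ℝ) (j : ℕ) : ℝ :=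
  if j ≤ m then ((d.factorial : ℕ) : ℝ) / (((m + d).factorial : ℕ) : ℝ) *
    (ffact s j * ffact (((m + d : ℕ) : ℝ) - s) (m - j)) else 0

/-- Unfolding `hyperCont` for `j ≤ m`. [folklore] -/
private theorem hyperCont_of_le {m j : ℕ} (hj : j ≤ m) (d : ℕ) (s : ℝ) :
    hyperCont m d s j = ((d.factorial : ℕ) : ℝ) / (((m + d).factorial : ℕ) : ℝ) *
      (ffact s j * ffact (((m + d : ℕ) : ℝ) - s) (m - j)) := by
  rw [hyperCont, if_pos hj]

/-- Unfolding `hyperCont` for `j > m`. [folklore] -/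
private theorem hyperCont_of_lt {m j : ℕ} (hj : m < j) (d : ℕ) (s : ℝ) : hyperCont m d s j = 0 := by
  rw [hyperCont, if_neg (by omega)]

/-- **Total mass one for every real sample size**: `Σ_{j ≤ m} C(m,j) · hyperCont m d s j = 1`
(falling-factorial Chu–Vandermonde with `r = s`, `r + s' = m + d`). [cite: AndrewsAskeyRoy1999, Cor. 2.2.3] -/
theorem sum_choose_mul_hyperCont (m d : ℕ) (s : ℝ) :
    ∑ j ∈ range (m + 1), (m.choose j : ℝ) * hyperCont m d s j = 1 := by
  have hV := ffact_add s (((m + d : ℕ) : ℝ) - s) m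
  rw [show s + ((((m + d : ℕ) : ℝ)) - s) = ((m + d : ℕ) : ℝ) by ring, ffact_natCast,
    Finset.Nat.sum_antidiagonal_eq_sum_range_succ_mk] at hV
  have hsum : ∑ j ∈ range (m + 1), (m.choose j : ℝ) * hyperCont m d s j =
      ((d.factorial : ℕ) : ℝ) / (((m + d).factorial : ℕ) : ℝ) *
        ∑ j ∈ range (m + 1), (m.choose j : ℝ) * (ffact s j * ffact (((m + d : ℕ) : ℝ) - s) (m - j)) := by
    rw [mul_sum]
    refine sum_congr rfl fun j hj => ?_
    rw [hyperCont_of_le (by rw [mem_range] at hj; omega)]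
    ring
  rw [hsum, ← hV]
  have hf : ((d.factorial : ℕ) : ℝ) * (((m + d).descFactorial m : ℕ) : ℝ) = (((m + d).factorial : ℕ) : ℝ) := by
    have h := Nat.factorial_mul_descFactorial (Nat.le_add_right m d)
    rw [Nat.add_sub_cancel_left] at h
    exact_mod_cast h
  rw [div_mul_eq_mul_div, hf, div_self]
  exact_mod_cast (Nat.factorial_pos _).ne'

/-- **At natural sample sizes the continuation IS the hypergeometric law**: for `s ≤ m + d`,
`C(m,j) · hyperCont m d s j = (hyperLaw m d s).coeff j` (`= C(m,j)C(d,s−j)/C(m+d,s)` for `j ≤ s`, `0` otherwise).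
[cite: KocherlakotaKocherlakota2017, §6.3 eq. (6.3.1)] -/
theorem choose_mul_hyperCont_natCast {m d s : ℕ} (hs : s ≤ m + d) (j : ℕ) :
    (m.choose j : ℝ) * hyperCont m d (s : ℝ) j = (hyperLaw m d s).coeff j := by
  rw [coeff_hyperLaw]
  rcases le_or_gt j m with hjm | hjm
  · rw [hyperCont_of_le hjm, ← Nat.cast_sub hs, ffact_natCast, ffact_natCast]
    rcases le_or_gt j s with hjs | hjs
    · rw [if_pos hjs]
      rcases le_or_gt (m - j) (m + d - s) with hk | hk
      · -- the genuine case: reparametrise `m = j + k`, `s = j + u`, `d = u + v` (no truncated subtraction left)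
        obtain ⟨k, rfl⟩ := Nat.exists_eq_add_of_le hjm
        obtain ⟨u, rfl⟩ := Nat.exists_eq_add_of_le hjs
        have hud : u ≤ d := by omega
        obtain ⟨v, rfl⟩ := Nat.exists_eq_add_of_le hud
        have e1 : j + k + (u + v) - (j + u) = k + v := by omega
        have e2 : j + k - j = k := by omega
        have e3 : j + u - j = u := by omega
        rw [e1, e2, e3]
        -- the five factorial identities
        have h1 : (((j + k).choose j : ℕ) : ℝ) * (k.factorial : ℕ) * (j.factorial : ℕ) = ((j + k).factorial : ℕ) := by
          have := Nat.add_choose_mul_factorial_mul_factorial k j; rw [add_comm k j] at this; exact_mod_cast this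
        have h2 : ((u.factorial : ℕ) : ℝ) * ((j + u).descFactorial j : ℕ) = ((j + u).factorial : ℕ) := by
          have := Nat.factorial_mul_descFactorial (Nat.le_add_right j u); rw [Nat.add_sub_cancel_left] at this
          exact_mod_cast this
        have h3 : ((v.factorial : ℕ) : ℝ) * ((k + v).descFactorial k : ℕ) = ((k + v).factorial : ℕ) := by
          have := Nat.factorial_mul_descFactorial (Nat.le_add_right k v); rw [Nat.add_sub_cancel_left] at this
          exact_mod_cast this
        have h4 : (((u + v).choose u : ℕ) : ℝ) * (v.factorial : ℕ) * (u.factorial : ℕ) = ((u + v).factorial : ℕ) := by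
          have := Nat.add_choose_mul_factorial_mul_factorial v u; rw [add_comm v u] at this; exact_mod_cast this
        have h5 : (((j + k + (u + v)).choose (j + u) : ℕ) : ℝ) * ((k + v).factorial : ℕ) * ((j + u).factorial : ℕ) =
            ((j + k + (u + v)).factorial : ℕ) := by
          have := Nat.add_choose_mul_factorial_mul_factorial (k + v) (j + u)
          rw [show k + v + (j + u) = j + k + (u + v) by ring] at this; exact_mod_cast this
        have fj : ((j.factorial : ℕ) : ℝ) ≠ 0 := by exact_mod_cast (Nat.factorial_pos _).ne'
        have fk : ((k.factorial : ℕ) : ℝ) ≠ 0 := by exact_mod_cast (Nat.factorial_pos _).ne'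
        have fu : ((u.factorial : ℕ) : ℝ) ≠ 0 := by exact_mod_cast (Nat.factorial_pos _).ne'
        have fv : ((v.factorial : ℕ) : ℝ) ≠ 0 := by exact_mod_cast (Nat.factorial_pos _).ne'
        have fju : (((j + u).factorial : ℕ) : ℝ) ≠ 0 := by exact_mod_cast (Nat.factorial_pos _).ne'
        have fkv : (((k + v).factorial : ℕ) : ℝ) ≠ 0 := by exact_mod_cast (Nat.factorial_pos _).ne'
        have fN : (((j + k + (u + v)).factorial : ℕ) : ℝ) ≠ 0 := by exact_mod_cast (Nat.factorial_pos _).ne'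
        have g1 : (((j + k).choose j : ℕ) : ℝ) = ((j + k).factorial : ℕ) / ((k.factorial : ℕ) * (j.factorial : ℕ)) := by
          rw [eq_div_iff (mul_ne_zero fk fj), ← h1]; ring
        have g2 : (((j + u).descFactorial j : ℕ) : ℝ) = ((j + u).factorial : ℕ) / (u.factorial : ℕ) := by
          rw [eq_div_iff fu, ← h2]; ring
        have g3 : (((k + v).descFactorial k : ℕ) : ℝ) = ((k + v).factorial : ℕ) / (v.factorial : ℕ) := by
          rw [eq_div_iff fv, ← h3]; ring
        have g4 : (((u + v).choose u : ℕ) : ℝ) = ((u + v).factorial : ℕ) / ((v.factorial : ℕ) * (u.factorial : ℕ)) := by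
          rw [eq_div_iff (mul_ne_zero fv fu), ← h4]; ring
        have g5 : (((j + k + (u + v)).choose (j + u) : ℕ) : ℝ) =
            ((j + k + (u + v)).factorial : ℕ) / (((k + v).factorial : ℕ) * ((j + u).factorial : ℕ)) := by
          rw [eq_div_iff (mul_ne_zero fkv fju), ← h5]; ring
        rw [Nat.cast_mul, g1, g2, g3, g4, g5]
        field_simp
      · -- too many marked balls requested from the complement: both sides vanish
        have hz : (m + d - s).descFactorial (m - j) = 0 := Nat.descFactorial_eq_zero_iff_lt.mpr hk
        have hz' : d.choose (s - j) = 0 := Nat.choose_eq_zero_of_lt (by omega)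
        rw [hz, hz', Nat.mul_zero, Nat.cast_zero, mul_zero, mul_zero, mul_zero, zero_div]
    · rw [if_neg (by omega), Nat.descFactorial_eq_zero_iff_lt.mpr hjs, Nat.cast_zero, zero_mul, mul_zero,
        mul_zero]
  · rw [hyperCont_of_lt hjm, mul_zero, Nat.choose_eq_zero_of_lt hjm]
    simp

/-- **Positivity on the widened range**: if `j ≤ m`, `j < s + 1` and `m − j < (m + d − s) + 1` then
`hyperCont m d s j > 0` (every factor of both falling factorials is positive; at natural `s` this is the positivity of the
hypergeometric weights on their range). [cite: GrahamKnuthPatashnik1994, §2.6 eq. (2.43)] [cite: KocherlakotaKocherlakota2017, §6.3 eq. (6.3.1)] -/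
theorem hyperCont_pos {m d j : ℕ} {s : ℝ} (hj : j ≤ m) (h₁ : (j : ℝ) < s + 1)
    (h₂ : ((m - j : ℕ) : ℝ) < (((m + d : ℕ) : ℝ) - s) + 1) : 0 < hyperCont m d s j := by
  rw [hyperCont_of_le hj]
  refine mul_pos (div_pos ?_ ?_) (mul_pos (ffact_pos h₁) (ffact_pos h₂))
  · exact_mod_cast Nat.factorial_pos _
  · exact_mod_cast Nat.factorial_pos _

/-! ### §3 The shell form: the continued level-0 law of a matching of H-type `(a,b,d)` -/

/-- `hyperCont` alone at natural sample sizes: `hyperCont m d s j = C(d,s−j)/C(m+d,s)` for `j ≤ s`, `0` for `j > s`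
(`j ≤ m`, `s ≤ m + d`). [cite: KocherlakotaKocherlakota2017, §6.3 eq. (6.3.1)] -/
theorem hyperCont_natCast {m d s j : ℕ} (hs : s ≤ m + d) (hj : j ≤ m) :
    hyperCont m d (s : ℝ) j = if j ≤ s then ((d.choose (s - j) : ℕ) : ℝ) / ((m + d).choose s : ℕ) else 0 := by
  have h := choose_mul_hyperCont_natCast (d := d) hs j
  rw [coeff_hyperLaw] at h
  have hc : (m.choose j : ℝ) ≠ 0 := by exact_mod_cast (Nat.choose_pos hj).ne'
  split_ifs at h with hjs
  · rw [if_pos hjs]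
    rw [Nat.cast_mul, mul_div_assoc] at h
    exact mul_left_cancel₀ hc h
  · rw [if_neg hjs]
    rcases mul_eq_zero.mp h with h0 | h0
    · exact absurd h0 hc
    · exact h0

/-- Pascal's rule summed: `Σ_{i ≤ n+1} C(n+1,i)·G i = Σ_{i ≤ n} C(n,i)·G (i+1) + Σ_{i ≤ n} C(n,i)·G i`. [folklore] -/
private theorem sum_choose_succ_mul (n : ℕ) (G : ℕ → ℝ) :
    ∑ i ∈ range (n + 1 + 1), ((n + 1).choose i : ℝ) * G i =
      ∑ i ∈ range (n + 1), (n.choose i : ℝ) * G (i + 1) + ∑ i ∈ range (n + 1), (n.choose i : ℝ) * G i := by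
  rw [sum_range_succ' _ (n + 1)]
  simp only [Nat.choose_succ_succ, Nat.cast_add, add_mul, sum_add_distrib, Nat.choose_zero_right, Nat.cast_one, one_mul]
  rw [add_assoc]
  congr 1
  rw [sum_range_succ' (fun i => (n.choose i : ℝ) * G i) n, sum_range_succ (fun i => (n.choose (i + 1) : ℝ) * G (i + 1)) n]
  simp [Nat.choose_succ_self]

/-- **Vandermonde folding**: `Σ_{α ≤ a} C(a,α) · Σ_{β ≤ b} C(b,β) · w(α+β) = Σ_{j ≤ a+b} C(a+b,j) · w j`
(Vandermonde's convolution `Σ_{α+β=j} C(a,α)C(b,β) = C(a+b,j)` against an arbitrary weight `w`).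
[cite: GrahamKnuthPatashnik1994, §5.1 eq. (5.27)] -/
theorem sum_choose_mul_sum_choose_mul (b : ℕ) : ∀ (a : ℕ) (w : ℕ → ℝ),
    ∑ α ∈ range (a + 1), (a.choose α : ℝ) * ∑ β ∈ range (b + 1), (b.choose β : ℝ) * w (α + β) =
      ∑ j ∈ range (a + b + 1), ((a + b).choose j : ℝ) * w j
  | 0, w => by simp
  | a + 1, w => by
    have IH0 := sum_choose_mul_sum_choose_mul b a w
    have IH1 := sum_choose_mul_sum_choose_mul b a (fun i => w (i + 1))
    rw [sum_choose_succ_mul a (fun α => ∑ β ∈ range (b + 1), (b.choose β : ℝ) * w (α + β))]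
    simp only [add_right_comm _ 1 _] at IH1 ⊢
    rw [IH0, IH1, sum_choose_succ_mul (a + b) w]

/-- The CONTINUED LEVEL-0 LAW of `x = |U ∩ H|` for the union `U` of `s` edges of a matching with `a` edges inside
`H`, `b` mixed edges and `d` edges outside `H` (`N = a + b + d`), `s` real: an `α`-subset of the inner edges
contributes `2α` to `x`, a `β`-subset of the mixed edges contributes `β`, and `j = α + β` H-touching edges are used,
so `contLevelZeroLaw a b d s x = Σ_{α ≤ a, β ≤ b, 2α+β = x} C(a,α)·C(b,β)·hyperCont (a+b) d s (α+β)` — the law of the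
linear statistic `2K₁ + K₂` of Guldberg's trivariate hypergeometric vector, continued in the sample size.
[cite: KocherlakotaKocherlakota2017, §6.2 eq. (6.2.4)] -/
def contLevelZeroLaw (a b d : ℕ) (s : ℝ) (x : ℕ) : ℝ :=
  ∑ α ∈ range (a + 1), ∑ β ∈ range (b + 1),
    if 2 * α + β = x then (a.choose α : ℝ) * ((b.choose β : ℝ) * hyperCont (a + b) d s (α + β)) else 0

/-- **Total mass one for every real `s`**: `Σ_{x ≤ 2a+b} contLevelZeroLaw a b d s x = 1`.
[cite: AndrewsAskeyRoy1999, Cor. 2.2.3] [cite: GrahamKnuthPatashnik1994, §5.1 eq. (5.27)] -/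
theorem sum_contLevelZeroLaw (a b d : ℕ) (s : ℝ) :
    ∑ x ∈ range (2 * a + b + 1), contLevelZeroLaw a b d s x = 1 := by
  unfold contLevelZeroLaw
  rw [sum_comm]
  have h1 : ∀ α ∈ range (a + 1), ∑ x ∈ range (2 * a + b + 1), ∑ β ∈ range (b + 1),
      (if 2 * α + β = x then (a.choose α : ℝ) * ((b.choose β : ℝ) * hyperCont (a + b) d s (α + β)) else 0) =
      (a.choose α : ℝ) * ∑ β ∈ range (b + 1), (b.choose β : ℝ) * hyperCont (a + b) d s (α + β) := by
    intro α hα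
    rw [mem_range] at hα
    rw [sum_comm, mul_sum]
    refine sum_congr rfl fun β hβ => ?_
    rw [mem_range] at hβ
    rw [sum_ite_eq, if_pos (by rw [mem_range]; omega)]
  rw [sum_congr rfl h1, sum_choose_mul_sum_choose_mul b a (fun j => hyperCont (a + b) d s j)]
  exact sum_choose_mul_hyperCont (a + b) d s

/-- **At natural `s ≤ N` the continued level-0 law is the three-type level-0 law**
`Σ_{2α+β = x} C(a,α)·C(b,β)·C(d, s−α−β)/C(N,s)` (the count of `ShellLawLevelStep.card_shellIn_zero_types` divided
by `C(N,s)`). [cite: KocherlakotaKocherlakota2017, §6.2 eq. (6.2.4)] -/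
theorem contLevelZeroLaw_natCast {a b d s : ℕ} (hs : s ≤ a + b + d) (x : ℕ) :
    contLevelZeroLaw a b d (s : ℝ) x = ∑ α ∈ range (a + 1), ∑ β ∈ range (b + 1),
      if 2 * α + β = x then (if α + β ≤ s then
        (a.choose α : ℝ) * ((b.choose β : ℝ) * (((d.choose (s - (α + β)) : ℕ) : ℝ) / ((a + b + d).choose s : ℕ)))
        else 0) else 0 := by
  unfold contLevelZeroLaw
  refine sum_congr rfl fun α hα => sum_congr rfl fun β hβ => ?_
  rw [mem_range] at hα hβ
  split_ifs with hx hj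
  · rw [hyperCont_natCast hs (by omega), if_pos hj]
  · rw [hyperCont_natCast hs (by omega), if_neg hj, mul_zero, mul_zero]
  · rfl

end Literature.Combinatorics.StablePolynomials
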